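import Mathlib
import Summits.AtomisticToContinuum.FouriersLaw.Theses.EmbeddedDrudeMourre
import Summits.AtomisticToContinuum.FouriersLaw.Theorems.EmbeddedDrudeMourreDrudeDissolutionStubExcursionSecondDifferenceCriticalSet
import Summits.AtomisticToContinuum.FouriersLaw.Theorems.EmbeddedDrudeMourreMourreDissolutionContinuousDensityAssemblyAux
import HarnessLib

/-!
# Geometry of the free pair resonance for stub B1b″ of line `kinetic-polymer-gas-on-the-time-axis`:
# a uniform gradient floor for `Ω` away from its critical set
(crux `EmbeddedDrudeMourre.DrudeDissolution`, item stmt-AtomisticToContinuum-12593; `--supports` file, closes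
nothing; lead c13, sub-goal M5b-far of the B1b″ plan)

WHAT. `resonanceFn_gradient_floor_far`: for `ω₂ > 0` and every `η > 0` there is `c > 0` such that the Fréchet
derivative of `p = (k₁,(k₃,k₂)) ↦ Ω(k₁,k₂,k₃) = ω₁ + ω₂ − ω₃ − ω₄` has operator norm `≥ c` at every point of `ℝ³`
that is `η`-away, in the explicit periodic sense below, from the critical set of `Ω` on the torus
(`resonanceFn_criticalSet`: the curves `{k₃ ≡ k₁, v₂ = v₁}`, `{k₃ ≡ k₂, v₁ = v₂}` inside the exchange planes and
the two extrema `(0,0,π)`, `(π,π,0)` mod `2π`):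
`(η ≤ |sin((k₃−k₁)/2)| ∨ η ≤ |v(k₂) − v(k₁)|) ∧ (η ≤ |sin((k₃−k₂)/2)| ∨ η ≤ |v(k₂) − v(k₁)|) ∧`
`η ≤ |1 − cos k₁| + |1 − cos k₂| + |1 + cos k₃| ∧ η ≤ |1 + cos k₁| + |1 + cos k₂| + |1 − cos k₃|`.
This is the `η`-independent floor on the bulk of the cell that the second-difference estimate B1b″ uses outside
the tubes around the critical curves (where the Morse–Bott floor takes over) and the corner balls.

HOW. Compactness: the constraint set meets the closed cell `[−π,π]³` in a compact set on which the continuous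
function `p ↦ ‖DΩ(p)‖` (`Ω` is `C¹`, `contAsm_contDiff_resonanceFn`) does not vanish — a zero of `DΩ` has four
equal group velocities (`contAsm_velocity_eq_of_fderiv_eq_zero`), hence lies on the critical set
(`resonanceFn_criticalSet`), which the constraints exclude — so it has a positive minimum there
(`IsCompact.exists_isMinOn`); every point of `ℝ³` is a `2πℤ³`-translate of a point of the cell, and both the
constraints and `DΩ` are `2πℤ³`-periodic (`fderiv_comp_add_right`).
-/

noncomputable section

open Set Real Topology
open Literature.MathematicalPhysics.KineticTheory
open Literature.MathematicalPhysics.KineticTheory.PhononBoltzmann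

namespace Summit.AtomisticToContinuum.FouriersLaw.Theorems.DrudeDissolution.KineticPolymerGasOnTheTimeAxis

/-! ### Periodicity of `Ω` and of its derivative -/

/-- `Ω` read at `p = (k₁,(k₃,k₂))` is invariant under the translation by `2π(n₁,(n₃,n₂))`, `nⱼ ∈ ℤ`. [folklore] -/
theorem resonanceFn₃_add_int_mul (ω₂ : ℝ) (p : ℝ × ℝ × ℝ) (n₁ n₂ n₃ : ℤ) :
    resonanceFn ω₂ (p + (2 * Real.pi * n₁, 2 * Real.pi * n₃, 2 * Real.pi * n₂)).1
        (p + (2 * Real.pi * n₁, 2 * Real.pi * n₃, 2 * Real.pi * n₂)).2.2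
        (p + (2 * Real.pi * n₁, 2 * Real.pi * n₃, 2 * Real.pi * n₂)).2.1 =
      resonanceFn ω₂ p.1 p.2.2 p.2.1 := by
  have hp := dispersion_periodic ω₂
  simp only [Prod.fst_add, Prod.snd_add]
  unfold resonanceFn
  have e1 : p.1 + 2 * Real.pi * n₁ = p.1 + n₁ * (2 * Real.pi) := by ring
  have e2 : p.2.2 + 2 * Real.pi * n₂ = p.2.2 + n₂ * (2 * Real.pi) := by ring
  have e3 : p.2.1 + 2 * Real.pi * n₃ = p.2.1 + n₃ * (2 * Real.pi) := by ring
  have e4 : p.1 + 2 * Real.pi * n₁ + (p.2.2 + 2 * Real.pi * n₂) - (p.2.1 + 2 * Real.pi * n₃) =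
      (p.1 + p.2.2 - p.2.1) + ((n₁ + n₂ - n₃ : ℤ) : ℝ) * (2 * Real.pi) := by push_cast; ring
  rw [e4, hp.int_mul, e1, hp.int_mul, e2, hp.int_mul, e3, hp.int_mul]

/-- The Fréchet derivative of `Ω` (read at `p = (k₁,(k₃,k₂))`) is `2πℤ³`-periodic. [folklore] -/
theorem fderiv_resonanceFn₃_add_int_mul (ω₂ : ℝ) (p : ℝ × ℝ × ℝ) (n₁ n₂ n₃ : ℤ) :
    fderiv ℝ (fun q : ℝ × ℝ × ℝ => resonanceFn ω₂ q.1 q.2.2 q.2.1)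
        (p + (2 * Real.pi * n₁, 2 * Real.pi * n₃, 2 * Real.pi * n₂)) =
      fderiv ℝ (fun q : ℝ × ℝ × ℝ => resonanceFn ω₂ q.1 q.2.2 q.2.1) p := by
  have hfun : (fun q : ℝ × ℝ × ℝ => resonanceFn ω₂
      (q + (2 * Real.pi * n₁, 2 * Real.pi * n₃, 2 * Real.pi * n₂)).1
      (q + (2 * Real.pi * n₁, 2 * Real.pi * n₃, 2 * Real.pi * n₂)).2.2
      (q + (2 * Real.pi * n₁, 2 * Real.pi * n₃, 2 * Real.pi * n₂)).2.1) =
      fun q : ℝ × ℝ × ℝ => resonanceFn ω₂ q.1 q.2.2 q.2.1 := by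
    funext q
    exact resonanceFn₃_add_int_mul ω₂ q n₁ n₂ n₃
  have h := fderiv_comp_add_right (𝕜 := ℝ) (f := fun q : ℝ × ℝ × ℝ => resonanceFn ω₂ q.1 q.2.2 q.2.1)
    (x := p) (2 * Real.pi * n₁, 2 * Real.pi * n₃, 2 * Real.pi * n₂)
  rw [hfun] at h
  exact h.symm

/-! ### Reduction of a point of `ℝ³` to the closed cell -/

/-- Every real number is a `2πℤ`-translate of a point of `[−π, π]`. [folklore] -/
theorem exists_int_mem_Icc_sub_two_pi_mul (x : ℝ) :
    ∃ n : ℤ, x - 2 * Real.pi * n ∈ Icc (-Real.pi) Real.pi := by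
  refine ⟨toIocDiv Real.two_pi_pos (-Real.pi) x, ?_⟩
  have hmem := toIocMod_mem_Ioc Real.two_pi_pos (-Real.pi) x
  rw [← self_sub_toIocDiv_zsmul Real.two_pi_pos (-Real.pi) x, zsmul_eq_mul] at hmem
  rw [show -Real.pi + 2 * Real.pi = Real.pi by ring] at hmem
  rw [show x - 2 * Real.pi * (toIocDiv Real.two_pi_pos (-Real.pi) x : ℝ) =
    x - (toIocDiv Real.two_pi_pos (-Real.pi) x : ℝ) * (2 * Real.pi) by ring]
  exact Ioc_subset_Icc_self hmem

/-- `|sin(θ + πj)| = |sin θ|` for `j ∈ ℤ`. [folklore] -/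
theorem abs_sin_add_int_mul_pi (θ : ℝ) (j : ℤ) : |Real.sin (θ + j * Real.pi)| = |Real.sin θ| := by
  rw [Real.sin_add_int_mul_pi, abs_mul, abs_zpow, abs_neg, abs_one, one_zpow, one_mul]

/-! ### The floor -/

/-- **Registered sub-goal `resonanceFn_gradient_floor_far` (M5b-far of stub B1b″): a uniform gradient floor for the
free pair resonance away from its critical set.** For `ω₂ > 0` and `η > 0` there is `c > 0` such that at every
`p = (k₁,(k₃,k₂)) ∈ ℝ³` with
`(η ≤ |sin((k₃−k₁)/2)| ∨ η ≤ |v(k₂)−v(k₁)|)`, `(η ≤ |sin((k₃−k₂)/2)| ∨ η ≤ |v(k₂)−v(k₁)|)`,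
`η ≤ |1−cos k₁| + |1−cos k₂| + |1+cos k₃|` and `η ≤ |1+cos k₁| + |1+cos k₂| + |1−cos k₃|`
(i.e. `η`-away from the co-moving curves in the exchange planes and from the two extremal points, all mod `2π`;
`v = groupVelocity ω₂`), the derivative of `Ω` has norm at least `c`:
`c ≤ ‖fderiv ℝ (p ↦ Ω(p.1, p.2.2, p.2.1)) p‖`. [folklore] -/
theorem resonanceFn_gradient_floor_far :
    ∀ ω₂ : ℝ, 0 < ω₂ → ∀ η : ℝ, 0 < η → ∃ c : ℝ, 0 < c ∧ ∀ p : ℝ × ℝ × ℝ,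
      (η ≤ |Real.sin ((p.2.1 - p.1) / 2)| ∨ η ≤ |groupVelocity ω₂ p.2.2 - groupVelocity ω₂ p.1|) →
      (η ≤ |Real.sin ((p.2.1 - p.2.2) / 2)| ∨ η ≤ |groupVelocity ω₂ p.2.2 - groupVelocity ω₂ p.1|) →
      η ≤ |1 - Real.cos p.1| + |1 - Real.cos p.2.2| + |1 + Real.cos p.2.1| →
      η ≤ |1 + Real.cos p.1| + |1 + Real.cos p.2.2| + |1 - Real.cos p.2.1| →
      c ≤ ‖fderiv ℝ (fun q : ℝ × ℝ × ℝ => resonanceFn ω₂ q.1 q.2.2 q.2.1) p‖ := by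
  intro ω₂ hω η hη
  -- the `C¹` map and the continuity of the norm of its derivative
  set F : ℝ × ℝ × ℝ → ℝ := fun q => resonanceFn ω₂ q.1 q.2.2 q.2.1 with hFdef
  have hF1 : ContDiff ℝ 1 F := MourreDissolution.contAsm_contDiff_resonanceFn hω
  have hcont : Continuous fun p => ‖fderiv ℝ F p‖ := (hF1.continuous_fderiv one_ne_zero).norm
  have hdc : Continuous (dispersion ω₂) :=
    continuous_iff_continuousAt.2 fun k => (hasDerivAt_dispersion hω k).continuousAt
  have hvc : Continuous (groupVelocity ω₂) := by
    unfold groupVelocity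
    exact Real.continuous_sin.div hdc fun k => (dispersion_pos hω k).ne'
  -- the constraint set
  set S : Set (ℝ × ℝ × ℝ) := {p |
      (η ≤ |Real.sin ((p.2.1 - p.1) / 2)| ∨ η ≤ |groupVelocity ω₂ p.2.2 - groupVelocity ω₂ p.1|) ∧
      (η ≤ |Real.sin ((p.2.1 - p.2.2) / 2)| ∨ η ≤ |groupVelocity ω₂ p.2.2 - groupVelocity ω₂ p.1|) ∧
      η ≤ |1 - Real.cos p.1| + |1 - Real.cos p.2.2| + |1 + Real.cos p.2.1| ∧
      η ≤ |1 + Real.cos p.1| + |1 + Real.cos p.2.2| + |1 - Real.cos p.2.1|} with hSdef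
  have c1 : Continuous fun p : ℝ × ℝ × ℝ => p.1 := continuous_fst
  have c3 : Continuous fun p : ℝ × ℝ × ℝ => p.2.1 := continuous_fst.comp continuous_snd
  have c2 : Continuous fun p : ℝ × ℝ × ℝ => p.2.2 := continuous_snd.comp continuous_snd
  have hv12 : Continuous fun p : ℝ × ℝ × ℝ => |groupVelocity ω₂ p.2.2 - groupVelocity ω₂ p.1| :=
    ((hvc.comp c2).sub (hvc.comp c1)).abs
  have hS : IsClosed S := by
    rw [hSdef]
    simp only [Set.setOf_and, Set.setOf_or]
    refine (IsClosed.union ?_ ?_).inter ((IsClosed.union ?_ ?_).inter (IsClosed.inter ?_ ?_))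
    · exact isClosed_le continuous_const ((Real.continuous_sin.comp ((c3.sub c1).div_const 2)).abs)
    · exact isClosed_le continuous_const hv12
    · exact isClosed_le continuous_const ((Real.continuous_sin.comp ((c3.sub c2).div_const 2)).abs)
    · exact isClosed_le continuous_const hv12
    · exact isClosed_le continuous_const
        ((((continuous_const.sub (Real.continuous_cos.comp c1)).abs).add
          ((continuous_const.sub (Real.continuous_cos.comp c2)).abs)).add
          ((continuous_const.add (Real.continuous_cos.comp c3)).abs))
    · exact isClosed_le continuous_const
        ((((continuous_const.add (Real.continuous_cos.comp c1)).abs).add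
          ((continuous_const.add (Real.continuous_cos.comp c2)).abs)).add
          ((continuous_const.sub (Real.continuous_cos.comp c3)).abs))
  -- the closed cell and the compact piece of the constraint set
  set K : Set (ℝ × ℝ × ℝ) := Icc (-Real.pi) Real.pi ×ˢ (Icc (-Real.pi) Real.pi ×ˢ Icc (-Real.pi) Real.pi)
    with hKdef
  have hK : IsCompact K := isCompact_Icc.prod (isCompact_Icc.prod isCompact_Icc)
  have hKS : IsCompact (K ∩ S) := hK.inter_right hS
  -- on the constraint set the derivative does not vanish
  have hne : ∀ p ∈ S, fderiv ℝ F p ≠ 0 := by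
    intro p hp h0
    rw [hSdef] at hp
    obtain ⟨hA, hB, hC, hD⟩ := hp
    obtain ⟨h12, h23, h34⟩ := MourreDissolution.contAsm_velocity_eq_of_fderiv_eq_zero hω h0
    have hv0 : |groupVelocity ω₂ p.2.2 - groupVelocity ω₂ p.1| = 0 := by
      rw [h12, sub_self, abs_zero]
    rcases resonanceFn_criticalSet ω₂ hω p.1 p.2.2 p.2.1 h12 h23 h34 with ⟨n, hn⟩ | ⟨n, hn⟩ | hc | hc
    · -- the plane `k₃ ≡ k₁`
      have hs : |Real.sin ((p.2.1 - p.1) / 2)| = 0 := by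
        rw [hn, show (p.1 + 2 * Real.pi * n - p.1) / 2 = 0 + n * Real.pi by ring,
          abs_sin_add_int_mul_pi, Real.sin_zero, abs_zero]
      rcases hA with h | h
      · rw [hs] at h; linarith
      · rw [hv0] at h; linarith
    · -- the plane `k₃ ≡ k₂`
      have hs : |Real.sin ((p.2.1 - p.2.2) / 2)| = 0 := by
        rw [hn, show (p.2.2 + 2 * Real.pi * n - p.2.2) / 2 = 0 + n * Real.pi by ring,
          abs_sin_add_int_mul_pi, Real.sin_zero, abs_zero]
      rcases hB with h | h
      · rw [hs] at h; linarith
      · rw [hv0] at h; linarith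
    · -- the corner `(0,0,π)`
      obtain ⟨e1, e2, e3⟩ := hc
      rw [e1, e2, e3] at hC
      norm_num at hC
      linarith
    · -- the corner `(π,π,0)`
      obtain ⟨e1, e2, e3⟩ := hc
      rw [e1, e2, e3] at hD
      norm_num at hD
      linarith
  -- a positive lower bound on the compact piece
  obtain ⟨c, hc, hcK⟩ : ∃ c : ℝ, 0 < c ∧ ∀ p ∈ K ∩ S, c ≤ ‖fderiv ℝ F p‖ := by
    by_cases hem : (K ∩ S).Nonempty
    · obtain ⟨p₀, hp₀, hmin⟩ := hKS.exists_isMinOn hem hcont.continuousOn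
      refine ⟨‖fderiv ℝ F p₀‖, norm_pos_iff.2 (hne p₀ hp₀.2), fun p hp => ?_⟩
      exact hmin hp
    · refine ⟨1, one_pos, fun p hp => ?_⟩
      exact absurd ⟨p, hp⟩ hem
  refine ⟨c, hc, fun p hA hB hC hD => ?_⟩
  -- reduce `p` to the cell by a `2πℤ³` translation
  obtain ⟨n₁, hn₁⟩ := exists_int_mem_Icc_sub_two_pi_mul p.1
  obtain ⟨n₃, hn₃⟩ := exists_int_mem_Icc_sub_two_pi_mul p.2.1
  obtain ⟨n₂, hn₂⟩ := exists_int_mem_Icc_sub_two_pi_mul p.2.2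
  set p' : ℝ × ℝ × ℝ := (p.1 - 2 * Real.pi * n₁, p.2.1 - 2 * Real.pi * n₃, p.2.2 - 2 * Real.pi * n₂)
    with hp'def
  have hpp' : p = p' + (2 * Real.pi * n₁, 2 * Real.pi * n₃, 2 * Real.pi * n₂) := by
    ext <;> simp [hp'def]
  have hK' : p' ∈ K := ⟨hn₁, hn₃, hn₂⟩
  -- the constraints are `2πℤ³`-periodic
  have hvper := groupVelocity_periodic ω₂
  have hv1 : groupVelocity ω₂ p'.1 = groupVelocity ω₂ p.1 := by
    have := hvper.int_mul n₁ (p.1 - 2 * Real.pi * n₁)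
    rw [show p.1 - 2 * Real.pi * n₁ + n₁ * (2 * Real.pi) = p.1 by ring] at this
    exact this.symm ▸ rfl
  have hv2 : groupVelocity ω₂ p'.2.2 = groupVelocity ω₂ p.2.2 := by
    have := hvper.int_mul n₂ (p.2.2 - 2 * Real.pi * n₂)
    rw [show p.2.2 - 2 * Real.pi * n₂ + n₂ * (2 * Real.pi) = p.2.2 by ring] at this
    exact this.symm ▸ rfl
  have hs1 : |Real.sin ((p'.2.1 - p'.1) / 2)| = |Real.sin ((p.2.1 - p.1) / 2)| := by
    have e : (p'.2.1 - p'.1) / 2 = (p.2.1 - p.1) / 2 + ((n₁ - n₃ : ℤ) : ℝ) * Real.pi := by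
      simp only [hp'def]; push_cast; ring
    rw [e, abs_sin_add_int_mul_pi]
  have hs2 : |Real.sin ((p'.2.1 - p'.2.2) / 2)| = |Real.sin ((p.2.1 - p.2.2) / 2)| := by
    have e : (p'.2.1 - p'.2.2) / 2 = (p.2.1 - p.2.2) / 2 + ((n₂ - n₃ : ℤ) : ℝ) * Real.pi := by
      simp only [hp'def]; push_cast; ring
    rw [e, abs_sin_add_int_mul_pi]
  have hcos1 : Real.cos p'.1 = Real.cos p.1 := by
    have := Real.cos_add_int_mul_two_pi (p.1 - 2 * Real.pi * n₁) n₁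
    rw [show p.1 - 2 * Real.pi * n₁ + n₁ * (2 * Real.pi) = p.1 by ring] at this
    exact this.symm ▸ rfl
  have hcos2 : Real.cos p'.2.2 = Real.cos p.2.2 := by
    have := Real.cos_add_int_mul_two_pi (p.2.2 - 2 * Real.pi * n₂) n₂
    rw [show p.2.2 - 2 * Real.pi * n₂ + n₂ * (2 * Real.pi) = p.2.2 by ring] at this
    exact this.symm ▸ rfl
  have hcos3 : Real.cos p'.2.1 = Real.cos p.2.1 := by
    have := Real.cos_add_int_mul_two_pi (p.2.1 - 2 * Real.pi * n₃) n₃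
    rw [show p.2.1 - 2 * Real.pi * n₃ + n₃ * (2 * Real.pi) = p.2.1 by ring] at this
    exact this.symm ▸ rfl
  have hS' : p' ∈ S := by
    rw [hSdef]
    refine ⟨?_, ?_, ?_, ?_⟩
    · rw [hs1, hv1, hv2]; exact hA
    · rw [hs2, hv1, hv2]; exact hB
    · rw [hcos1, hcos2, hcos3]; exact hC
    · rw [hcos1, hcos2, hcos3]; exact hD
  -- the derivative is `2πℤ³`-periodic
  have hder : fderiv ℝ F p = fderiv ℝ F p' := by
    rw [hpp']
    exact fderiv_resonanceFn₃_add_int_mul ω₂ p' n₁ n₂ n₃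
  rw [hder]
  exact hcK p' ⟨hK', hS'⟩

end Summit.AtomisticToContinuum.FouriersLaw.Theorems.DrudeDissolution.KineticPolymerGasOnTheTimeAxis

end
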